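import Mathlib.AlgebraicGeometry.Modules.Tilde
import Mathlib.CategoryTheory.HomCongr
import Mathlib.RingTheory.TensorProduct.Basic
import HarnessLib

/-!
# Formally free cokernel — global sections of a pull-back to an affine scheme are a base change

Helper file for stub ED (`stub_formallyFreeCokernel`) of line `chow-zariski-pushforward` of the crux
`PadicSemiregularLift.FormalVectorBundlesAlgebraize` (stmt-HodgeConjecture-14106). For a ring map
`φ : R → S`, `g = Spec φ : Spec S → Spec R`, and a quasi-coherent `𝒪_{Spec R}`-module `M` whose
pull-back `g^* M` (Mathlib `Scheme.Modules.pullback`) is quasi-coherent: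

* `exists_descEquiv` — for every `S`-module `Q`, `S`-linear maps `Γ(g^*M, ⊤) → Q` correspond
  bijectively to `R`-linear maps `Γ(M, ⊤) → Γ(g_* Q~, ⊤) = Q`, the bijection being
  `λ ↦ λ ∘ θ` where `θ : Γ(M, ⊤) → Γ(g^* M, ⊤)` is the unit of `g^* ⊣ g_*` on global sections
  (composite of: `M ≅ Γ(M)~` and `g^*M ≅ Γ(g^*M)~` (Mathlib `isIso_fromTildeΓ_of_isQuasicoherent`),
  full faithfulness of `~` and the `~ ⊣ Γ` adjunction (Mathlib `tilde.adjunction`), and the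
  adjunction `g^* ⊣ g_*`; the formula follows from `toOpen_fromTildeΓ_app`, `toOpen_map_app`);
* `nonempty_linearEquiv_baseChange_sections` — hence, for an `R`-algebra `S`,
  **`Γ(g^* M, ⊤) ≅ S ⊗_R Γ(M, ⊤)`** as `S`-modules (the universal property of the base change:
  Stacks 01I9 / EGA I 1.6.5, `(M~) ×_{Spec R} Spec S = (S ⊗_R M)~`, on global sections).

Everything is proved; no definitions.
-/

-- `Summit.HodgeConjecture.HodgeConjecture.…` repeats the summit name by the D-0017 layout (Sub = Summit).
set_option linter.dupNamespace false

noncomputable section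

universe u

open CategoryTheory AlgebraicGeometry Opposite TopologicalSpace TensorProduct

namespace Summit.HodgeConjecture.HodgeConjecture.Theorems.FormalVectorBundlesAlgebraize

variable {R S : CommRingCat.{u}} (φ : R ⟶ S)

/-- The global-sections functor `Γ` of `𝒪_{Spec R}`-modules (Mathlib `moduleSpecΓFunctor`) acts on a
morphism by its component over `⊤`. -/
theorem moduleSpecΓFunctor_map_apply {K K' : (Spec R).Modules} (χ : K ⟶ K') (x : Γ(K, ⊤)) :
    (moduleSpecΓFunctor (R := R)).map χ x = χ.app ⊤ x := rfl

/-- `Γ(K, ⊤) → Γ(Γ(K)~, ⊤) → Γ(K, ⊤)` (Mathlib `tilde.toOpen` followed by `Γ(fromTildeΓ)`) is the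
identity. -/
theorem toOpen_top_fromTildeΓ (K : (Spec R).Modules) :
    tilde.toOpen ((modulesSpecToSheaf.obj K).presheaf.obj (op ⊤)) ⊤ ≫
      (moduleSpecΓFunctor (R := R)).map K.fromTildeΓ = 𝟙 _ := by
  have h := Scheme.Modules.toOpen_fromTildeΓ_app K ⊤
  have hid : (homOfLE le_top : (⊤ : (Spec R).Opens) ⟶ ⊤) = 𝟙 _ := Subsingleton.elim _ _
  rw [hid, op_id, CategoryTheory.Functor.map_id] at h
  exact h

/-- For `K` quasi-coherent, `Γ(fromTildeΓ)⁻¹ = toOpen ⊤` on global sections. -/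
theorem inv_map_fromTildeΓ (K : (Spec R).Modules) [K.IsQuasicoherent] :
    inv ((moduleSpecΓFunctor (R := R)).map K.fromTildeΓ) =
      tilde.toOpen ((modulesSpecToSheaf.obj K).presheaf.obj (op ⊤)) ⊤ :=
  IsIso.inv_eq_of_inv_hom_id (toOpen_top_fromTildeΓ K)

/-- Naturality of `toOpen ⊤` (Mathlib `tilde.toOpen_map_app`), elementwise. -/
theorem toOpen_top_map_apply {A B : ModuleCat.{u} R} (l : A ⟶ B) (a : A) :
    (moduleSpecΓFunctor (R := R)).map (tilde.map l) (tilde.toOpen A ⊤ a) =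
      tilde.toOpen B ⊤ (l a) := by
  have h := tilde.toOpen_map_app l ⊤
  exact congr($h a)


/-- The unit of the `~ ⊣ Γ` adjunction is `toOpen ⊤`. -/
theorem tilde_adjunction_unit_app (A : ModuleCat.{u} R) :
    (tilde.adjunction (R := R)).unit.app A = tilde.toOpen A ⊤ := rfl

variable (M : (Spec R).Modules) [M.IsQuasicoherent]
  [((Scheme.Modules.pullback (Spec.map φ)).obj M).IsQuasicoherent]

set_option maxHeartbeats 400000 in
/-- **The descent equivalence.** For `g = Spec φ : Spec S → Spec R`, `M` quasi-coherent on `Spec R` with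
`g^*M` quasi-coherent, and an `S`-module `Q`: `S`-linear maps `Γ(g^*M, ⊤) → Q` correspond
bijectively to `R`-linear maps `Γ(M, ⊤) → Γ(g_* Q~, ⊤)`, via `λ ↦ (n ↦ λ (θ n))` read in
`Γ(Q~, ⊤) ⊇ Q`, where `θ` is the unit of `g^* ⊣ g_*` on global sections. -/
theorem exists_descEquiv (Q : ModuleCat.{u} S) :
    ∃ Φ : ((moduleSpecΓFunctor (R := S)).obj ((Scheme.Modules.pullback (Spec.map φ)).obj M) ⟶ Q) ≃
        ((moduleSpecΓFunctor (R := R)).obj M ⟶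
          (moduleSpecΓFunctor (R := R)).obj
            ((Scheme.Modules.pushforward (Spec.map φ)).obj (tilde Q))),
      ∀ (l : (moduleSpecΓFunctor (R := S)).obj ((Scheme.Modules.pullback (Spec.map φ)).obj M) ⟶ Q)
        (n : Γ(M, ⊤)),
        Φ l n = tilde.toOpen Q ⊤
          (l (((Scheme.Modules.pullbackPushforwardAdjunction (Spec.map φ)).unit.app M).app ⊤ n)) := by
  let g := Spec.map φ
  let adj := Scheme.Modules.pullbackPushforwardAdjunction g
  let P := (Scheme.Modules.pullback g).obj M
  have hP : IsIso P.fromTildeΓ := inferInstance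
  have hM : IsIso M.fromTildeΓ := inferInstance
  let eP : tilde ((modulesSpecToSheaf.obj P).presheaf.obj (op ⊤)) ≅ P := @asIso _ _ _ _ _ hP
  let eM : tilde ((modulesSpecToSheaf.obj M).presheaf.obj (op ⊤)) ≅ M := @asIso _ _ _ _ _ hM
  let Φ₁ : ((moduleSpecΓFunctor (R := S)).obj P ⟶ Q) ≃ (P ⟶ tilde Q) :=
    (tilde.fullyFaithfulFunctor (R := S)).homEquiv.trans (eP.homCongr (Iso.refl _))
  let Φ₂ : (P ⟶ tilde Q) ≃ (M ⟶ (Scheme.Modules.pushforward g).obj (tilde Q)) :=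
    adj.homEquiv M (tilde Q)
  let Φ₃ : (M ⟶ (Scheme.Modules.pushforward g).obj (tilde Q)) ≃
      ((moduleSpecΓFunctor (R := R)).obj M ⟶
        (moduleSpecΓFunctor (R := R)).obj ((Scheme.Modules.pushforward g).obj (tilde Q))) :=
    (eM.symm.homCongr (Iso.refl _)).trans ((tilde.adjunction (R := R)).homEquiv _ _)
  refine ⟨Φ₁.trans (Φ₂.trans Φ₃), fun l n => ?_⟩
  -- the value of the composite equivalence, as a composite of morphisms of `R`-modules
  have h1 : Φ₁.trans (Φ₂.trans Φ₃) l =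
      tilde.toOpen _ ⊤ ≫ (moduleSpecΓFunctor (R := R)).map (M.fromTildeΓ ≫ (adj.unit.app M ≫
        (Scheme.Modules.pushforward g).map (eP.inv ≫ (tilde.functor S).map l ≫ 𝟙 _)) ≫ 𝟙 _) := by
    rfl
  -- `Γ(fromTildeΓ) ∘ toOpen = id` on `Γ(M, ⊤)`
  have h2 : ∀ m : Γ(M, ⊤), (moduleSpecΓFunctor (R := R)).map M.fromTildeΓ
      (tilde.toOpen ((modulesSpecToSheaf.obj M).presheaf.obj (op ⊤)) ⊤ m) = m := fun m => by
    have h := toOpen_top_fromTildeΓ M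
    exact congr($h m)
  -- `Γ(fromTildeΓ⁻¹) = toOpen` on `Γ(P, ⊤)`
  have h3 : (moduleSpecΓFunctor (R := S)).map eP.inv =
      tilde.toOpen ((modulesSpecToSheaf.obj P).presheaf.obj (op ⊤)) ⊤ := by
    rw [show eP.inv = inv P.fromTildeΓ from rfl, Functor.map_inv, inv_map_fromTildeΓ]
  -- the unit on global sections, landing in `Γ(P, ⊤)`
  let θ : Γ(M, ⊤) → (moduleSpecΓFunctor (R := S)).obj P := fun m => (adj.unit.app M).app ⊤ m
  have h4 : Φ₁.trans (Φ₂.trans Φ₃) l n =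
      (moduleSpecΓFunctor (R := S)).map ((tilde.functor S).map l)
        ((moduleSpecΓFunctor (R := S)).map eP.inv
          (θ ((moduleSpecΓFunctor (R := R)).map M.fromTildeΓ
            (tilde.toOpen ((modulesSpecToSheaf.obj M).presheaf.obj (op ⊤)) ⊤ n)))) := by
    rw [h1, Category.comp_id, Category.comp_id]
    rfl
  rw [h4, h2 n, h3]
  exact toOpen_top_map_apply l _


section BaseChange

variable {R S : CommRingCat.{u}} [Algebra R S]

/-- Compatibility of the `R`-action on `Γ(g_* K, ⊤)` with the `S`-action on `Γ(K, ⊤)`. -/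
theorem smul_pushforward_sections (K : (Spec S).Modules) (b : R) (y : Γ(K, ⊤)) :
    ((b • (show Γ((Scheme.Modules.pushforward
        (Spec.map (CommRingCat.ofHom (algebraMap R S) : R ⟶ S))).obj K, ⊤) from y) :) : Γ(K, ⊤)) =
      algebraMap R S b • y := by
  let φ : R ⟶ S := CommRingCat.ofHom (algebraMap R S)
  have hB : ∀ r, (Spec R).presheaf.map (Opens.leTop (⊤ : (Spec R).Opens)).op r = r := by
    intro r
    rw [show (Opens.leTop _ : (⊤ : (Spec R).Opens) ⟶ ⊤) = 𝟙 _ from Subsingleton.elim _ _,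
      op_id, CategoryTheory.Functor.map_id]
    rfl
  have hS : ∀ r, (Spec S).presheaf.map (Opens.leTop (⊤ : (Spec S).Opens)).op r = r := by
    intro r
    rw [show (Opens.leTop _ : (⊤ : (Spec S).Opens) ⟶ ⊤) = 𝟙 _ from Subsingleton.elim _ _,
      op_id, CategoryTheory.Functor.map_id]
    rfl
  have hnat : (Scheme.ΓSpecIso S).inv (algebraMap R S b) =
      (Spec.map φ).appTop ((Scheme.ΓSpecIso R).inv b) := by
    have h := Scheme.ΓSpecIso_inv_naturality φ
    exact congr($h b)
  have key : ((Spec.map φ).app ⊤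
      ((Spec R).presheaf.map (Opens.leTop (⊤ : (Spec R).Opens)).op ((Scheme.ΓSpecIso R).inv b))) •
        (show Γ(K, (Spec.map φ) ⁻¹ᵁ ⊤) from y) =
      ((Spec S).presheaf.map (Opens.leTop (⊤ : (Spec S).Opens)).op
        ((Scheme.ΓSpecIso S).inv (algebraMap R S b))) • y := by
    rw [hB, hS, hnat]
    rfl
  exact key

set_option maxHeartbeats 800000 in
/-- **Global sections of the pull-back to `Spec S` are the base change `S ⊗_R Γ(M, ⊤)`.** -/
theorem nonempty_linearEquiv_baseChange_sections (M : (Spec R).Modules) [M.IsQuasicoherent]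
    [((Scheme.Modules.pullback
      (Spec.map (CommRingCat.ofHom (algebraMap R S) : R ⟶ S))).obj M).IsQuasicoherent] :
    Nonempty ((S ⊗[R] Γ(M, ⊤)) ≃ₗ[S]
      Γ((Scheme.Modules.pullback
        (Spec.map (CommRingCat.ofHom (algebraMap R S) : R ⟶ S))).obj M, ⊤)) := by
  let φ : R ⟶ S := CommRingCat.ofHom (algebraMap R S)
  let g := Spec.map φ
  let adj := Scheme.Modules.pullbackPushforwardAdjunction g
  let P := (Scheme.Modules.pullback g).obj M
  letI : Module R Γ(P, ⊤) := Module.compHom Γ(P, ⊤) (algebraMap R S)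
  haveI : IsScalarTower R S Γ(P, ⊤) := IsScalarTower.of_algebraMap_smul fun _ _ => rfl
  -- the unit on global sections, `R`-linear
  let θf : Γ(M, ⊤) → Γ(P, ⊤) := fun m => (adj.unit.app M).app ⊤ m
  let θ : Γ(M, ⊤) →ₗ[R] Γ(P, ⊤) :=
    { toFun := θf
      map_add' := fun m m' =>
        ((moduleSpecΓFunctor (R := R)).map (adj.unit.app M)).hom.map_add m m'
      map_smul' := fun b m =>
        (((moduleSpecΓFunctor (R := R)).map (adj.unit.app M)).hom.map_smul b m).trans
          (smul_pushforward_sections P b _) }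
  -- the inverse, from the descent equivalence
  let Q : ModuleCat.{u} S := ModuleCat.of S (S ⊗[R] Γ(M, ⊤))
  obtain ⟨Φ, hΦ⟩ := exists_descEquiv φ M Q
  let νf : Γ(M, ⊤) → Γ((Scheme.Modules.pushforward g).obj (tilde Q), ⊤) :=
    fun m => tilde.toOpen Q ⊤ ((1 : S) ⊗ₜ[R] m)
  have νf_smul : ∀ (b : R) (m : Γ(M, ⊤)), νf (b • m) = b • νf m := fun b m => by
    have h1 : νf (b • m) = tilde.toOpen Q ⊤ (algebraMap R S b • ((1 : S) ⊗ₜ[R] m)) := by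
      change tilde.toOpen Q ⊤ ((1 : S) ⊗ₜ[R] (b • m)) = _
      rw [TensorProduct.tmul_smul, algebraMap_smul]
    exact (h1.trans ((tilde.toOpen Q ⊤).hom.map_smul _ _)).trans
      (smul_pushforward_sections (tilde Q) b _).symm
  let νl : Γ(M, ⊤) →ₗ[R] Γ((Scheme.Modules.pushforward g).obj (tilde Q), ⊤) :=
    { toFun := νf
      map_add' := fun m m' => by
        change tilde.toOpen Q ⊤ ((1 : S) ⊗ₜ[R] (m + m')) = _
        rw [TensorProduct.tmul_add]
        exact (tilde.toOpen Q ⊤).hom.map_add _ _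
      map_smul' := νf_smul }
  let ν : (moduleSpecΓFunctor (R := R)).obj M ⟶
      (moduleSpecΓFunctor (R := R)).obj ((Scheme.Modules.pushforward g).obj (tilde Q)) :=
    (ModuleCat.ofHom νl :
      ModuleCat.of R Γ(M, ⊤) ⟶ ModuleCat.of R Γ((Scheme.Modules.pushforward g).obj (tilde Q), ⊤))
  let inv : Γ(P, ⊤) →ₗ[S] S ⊗[R] Γ(M, ⊤) := (Φ.symm ν).hom
  have hinv : ∀ m, inv (θ m) = (1 : S) ⊗ₜ[R] m := fun m => by
    have h := hΦ (Φ.symm ν) m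
    rw [Equiv.apply_symm_apply] at h
    have h' : tilde.toOpen Q ⊤ ((1 : S) ⊗ₜ[R] m) = tilde.toOpen Q ⊤ (inv (θ m)) := h
    exact ((ConcreteCategory.bijective_of_isIso (tilde.toOpen Q ⊤)).1 h').symm
  -- the comparison map and the two composites
  let lift : S ⊗[R] Γ(M, ⊤) →ₗ[S] Γ(P, ⊤) := θ.liftBaseChange S
  have h₁ : ∀ z, inv (lift z) = z := by
    intro z
    induction z using TensorProduct.induction_on with
    | zero =>
      calc inv (lift 0) = inv 0 := by rw [map_zero]
        _ = 0 := map_zero inv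
    | add x y hx hy =>
      calc inv (lift (x + y)) = inv (lift x + lift y) := by rw [map_add]
        _ = inv (lift x) + inv (lift y) := map_add inv _ _
        _ = x + y := by rw [hx, hy]
    | tmul s m =>
      calc inv (lift (s ⊗ₜ[R] m)) = inv (s • θ m) := rfl
        _ = s • inv (θ m) := inv.map_smul s (θ m)
        _ = s • ((1 : S) ⊗ₜ[R] m) := by rw [hinv]
        _ = s ⊗ₜ[R] m := by rw [TensorProduct.smul_tmul', smul_eq_mul, mul_one]
  have h₂ : ∀ x, lift (inv x) = x := by
    obtain ⟨Φ', hΦ'⟩ := exists_descEquiv φ M ((moduleSpecΓFunctor (R := S)).obj P)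
    let L : (moduleSpecΓFunctor (R := S)).obj P ⟶ (moduleSpecΓFunctor (R := S)).obj P :=
      (ModuleCat.ofHom (lift ∘ₗ inv) : ModuleCat.of S Γ(P, ⊤) ⟶ ModuleCat.of S Γ(P, ⊤))
    have key : Φ' L = Φ' (𝟙 _) := by
      apply ModuleCat.hom_ext
      apply LinearMap.ext
      intro m
      have e1 := hΦ' L m
      have e2 := hΦ' (𝟙 _) m
      have e3 : lift (inv (θ m)) = θ m := by
        rw [hinv, LinearMap.liftBaseChange_tmul, one_smul]
      exact e1.trans ((congrArg (tilde.toOpen ((moduleSpecΓFunctor (R := S)).obj P) ⊤) e3).trans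
        e2.symm)
    have hk := Φ'.injective key
    intro x
    exact congr($hk x)
  exact ⟨LinearEquiv.ofLinear lift inv (LinearMap.ext h₂) (LinearMap.ext h₁)⟩

end BaseChange


/-- **Registered sub-goal** (helper stub of `stub_formallyFreeCokernel`, universe `0`): global
sections of the pull-back of a quasi-coherent module to `Spec` of an algebra are the base change
(`nonempty_linearEquiv_baseChange_sections`). -/
theorem stub_ffcUnitBaseChange :
  ∀ (R S : CommRingCat.{0}) [Algebra R S] (M : (AlgebraicGeometry.Spec R).Modules) [M.IsQuasicoherent] [((AlgebraicGeometry.Scheme.Modules.pullback (AlgebraicGeometry.Spec.map (CommRingCat.ofHom (algebraMap R S) : R ⟶ S))).obj M).IsQuasicoherent], Nonempty (TensorProduct R S ((AlgebraicGeometry.Scheme.Modules.presheaf M).obj (Opposite.op ⊤)) ≃ₗ[S] (AlgebraicGeometry.Scheme.Modules.presheaf ((AlgebraicGeometry.Scheme.Modules.pullback (AlgebraicGeometry.Spec.map (CommRingCat.ofHom (algebraMap R S) : R ⟶ S))).obj M)).obj (Opposite.op ⊤)) :=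
  fun _ _ _ M _ _ => nonempty_linearEquiv_baseChange_sections M

end Summit.HodgeConjecture.HodgeConjecture.Theorems.FormalVectorBundlesAlgebraize

end
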